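import Summits.QuantumFields.BalabanUV.Beta.FP.GhostLoopCountingFar
import Summits.QuantumFields.BalabanUV.Beta.FP.MixLoopPowerCountingMass

/-!
# `BalabanUV.Beta.FP.GhostLoopCountingGramWords` — road «FP» for binder row D1, organisation γ, row **(GH-a) COUNTING** (owner ruling R-FP-28 (d),
# piece list N-d1leaf05g12-1 adopted), piece **(g5)** «THE GRAM LOOPS», PART 1 of 2: the (Mκ) letter of an ALL-MASSIVE piece, and the pointwise
# ALL-MASSIVE shapes of the two COARSE trace words `tr(M⁻¹·M̈_{bb′})`, `tr(M⁻¹·Ṁ_b·M⁻¹·Ṁ_{b′})` of the interpolation Gram `M = 𝓘ᵀ𝓘` (legs `M⁻¹` MASSIVE on the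
# coarse lattice — WCI —, insertions `Ṁ_b`, `M̈_{bb′}` exponentially localised at the blocks of the fine bonds `b`, `b′`)
# ([folklore] lattice bookkeeping on `ℤ⁴`; abstract kernels over FINITE windows; every letter a displayed hypothesis; NO road object; PART 2 = `FP/GhostLoopCountingGram`)

HONEST DEPENDENCY (page 1, mandatory): continuum YM on T⁴ ⇐ BetaPertH ∧ nine spine estimates (0/9 proved); BetaPertH ⇐ (D1) ∧ (D4) ∧
CAP+tail; G-an2-4 gates asym, D1 and NE2/3/4.  HONEST FRAMING (cell contract, verbatim): «discharging `BetaPertH` makes Bałaban's UV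
stability UNCONDITIONAL — a real constructive-QFT result; it is NOT the continuum limit and NOT the Clay problem.»  THIS MODULE is elementary
[folklore] real analysis on `ℤ⁴` composed BY NAME from the tree: `FP/MixLoopPowerCounting.sum_exp_le`∕`sum_sq_mul_exp_le` (exact powers `n⁴`, `n⁶`),
`FP/GhostLoopCountingFar.sum_exp_recentre_le` (the reference row weight's mass), `FP/MixLoopPowerCountingMass.supNorm_zsmul_natCast_real` (`‖n•z‖∞ = n‖z‖∞`),
the sup-norm triangle letters of `BlockLegs`∕`GradedBubbles`.  It asserts nothing about Bałaban's objects, cites nothing, mints no `Prop` fact, has no `def`, 0 sorry.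
NOT (GH-a) ((g1)(g2)(g3)(g4) are NOT here), NOT the (I-gh) letter (it supplies the instances of `C_M, C_D, C_D₂`), NOT `hbook`, NOT D1, NOT BetaPertH, NOT continuum, NOT Clay.

ABSOLUTE RULE (cell charter, verbatim): «No internally-minted statement may enter as a cited fact. Every hypothesis is either kernel-proved in this
package or a verbatim quotation of a PUBLISHED theorem with page reference. The manuscript(s) under audit are NOT citable for their own disputed
steps — they are the thing under adjudication; programme-internal (2001/route/tribunal) claims are never citable.»

ROW (road FP OWNER b2b-balaban-beta-d1-p3 gen 8, R-FP-28 (d), CLAIMS.log l.25755): «(g5) Gram loops `½·secondVar(𝓘ᵀ𝓘; Ṁ, M̈)` (legs `(𝓘ᵀ𝓘)⁻¹` massive,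
WCI ✓) — admissible».  PROVENANCE (precision E-d1leaf05g12-1): the Gram addend of the KKT form of record `FP/GhostGramJets.hasDerivAt_ghostFirstVar`
(`T^{gh} = secondVar 𝕂 + ½·secondVar(𝓘ᵀ𝓘) − ½·secondVar(QQᵀ)`), with the words `Ṁ = İᵀ𝓘 + 𝓘ᵀİ`, `M̈ = Ïᵀ𝓘 + 2İᵀİ + 𝓘ᵀÏ` of `FP/GhostGramJets{,Second}` ✓;
`secondVar M Ṁ M̈ = tr(M⁻¹M̈) − tr(M⁻¹ṀM⁻¹Ṁ)`.  Polarised in the two background insertions `b`, `b′` (weights `J b v₀`, `J b′ v`, the J-contraction currency of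
RHOA-6c′), the fine kernel is `k₅(b,b′) = ½·(Σ_{v,v′} M⁻¹(v′,v)·M̈_{bb′}(v,v′)) − ½·(Σ_{v₁…v₄} M⁻¹(v₁,v₂)·Ṁ_b(v₂,v₃)·M⁻¹(v₃,v₄)·Ṁ_{b′}(v₄,v₁))` — two trace words over
a FINITE coarse window `V`.  Nothing of those identities is used or restated here: `Minv`, `D`, `D₂` are ABSTRACT kernels with displayed letters.

BINDING CHECK (R-FP-28 (d), DISPLAYED): «legs `(𝓘ᵀ𝓘)⁻¹` massive» — NO long-range leg occurs; every factor is exponentially localised (the coarse inverse at rate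
`δ_M` per coarse step = WCI `WellConditionedInverseLocality.abs_inv_le_of_coercive_localised` shape; the insertions at rate `δ∕n` around their blocks) ⟹ the piece is
ALL-MASSIVE on scale `n`, pointwise `≤ C·e^{−(min(δ,δ_M)∕(2n))‖b′−b‖∞}` on the whole lattice (no window) ⟹ «(Mκ₅) admissible»; RISK R-γ-15 cannot arise.

THE LETTERS (`n ≥ 1`; `V` a finite coarse window; coarse `v` sits at the fine point `n•v`): (Minv) `|Minv v v′| ≤ C_M·e^{−δ_M‖v−v′‖∞}`;  (KM) `Σ_{v′∈V} e^{−(δ_M∕2)‖v−v′‖∞} ≤ K_M`;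
* (D) one insertion `|D b v v′| ≤ C_D·e^{−(δ∕n)‖b−n•v‖∞}·e^{−(δ∕n)‖b−n•v′‖∞}`;  (D₂) two insertions
  `|D₂ b b′ v v′| ≤ C_D₂·e^{−(δ∕n)‖b′−b‖∞}·e^{−(δ∕n)‖b−n•v‖∞}·e^{−(δ∕n)‖b′−n•v′‖∞}`;
* (KV) the half-rate block mass seen from a fine point `Σ_{v∈V} e^{−(δ∕(2n))‖b−n•v‖∞} ≤ K_V` (every `b`).  CONTENT ([folklore]; `Θ := 1 + 480·e^{δ∕4}·(4∕δ)⁴`;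
`c₃(a) := 1 + 480·e^{a∕2}·(2∕a)⁴`, `c₅(a) := 1 + 9600·e^{a∕2}·(2∕a)⁶`):
* §1 **`sum_massive_sqWeight_le`** (`Σ_{z∈T}(1 + (‖z−p‖∞∕n)²)·C·e^{−(a∕n)‖z−p‖∞} ≤ C·(c₃(a) + c₅(a))·n⁴`), **`majorantLetter_massive`** — an ALL-MASSIVE piece
  `|k b b′| ≤ C·e^{−(a∕n)‖b′−b‖∞}` has the (Mκ) letter `A_κ = Θ·n⁴·(C·(c₃(a) + c₅(a))·n⁴)` (powers displayed `n⁴·n⁴`; serves (g4)'s all-massive MIX shapes too).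
* §2 **`exp_chain_le`** (the half-exponentials along `b → n•v₂ → n•v₁ → b′` give `e^{−(a∕(2n))‖b′−b‖∞}`, `a = min δ δ_M`), **`abs_trace₂_le`** (`≤ C_M·C_D₂·K_V²·
  e^{−(δ∕n)‖b′−b‖∞}`), **`abs_trace₄_le`** (`|Σ_{v₁…v₄∈V} Minv v₁ v₂·D b v₂ v₃·Minv v₃ v₄·D b′ v₄ v₁| ≤ C_M²·C_D²·K_M²·K_V²·e^{−(min(δ,δ_M)∕(2n))‖b′−b‖∞}`).
INSTANCE SIZES (owner l.26333, kept ABSTRACT): `C_M, δ_M` = the WCI constants of `(𝓘ᵀ𝓘)⁻¹` (`𝓘ᵀ𝓘 ≥ ‖Q′‖⁻²`); `C_D ≍ (column sup of 𝓘)·(column sup of İ_b)`-type,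
`C_D₂ ≍ (column sup of İ)² + (column sup of 𝓘)·(column sup of Ï)`-type — quadratic in the (I-gh) column letters; their powers of `n` are pinned by KER-γ (β)
(R-FP-31), NOT here; `K_V, K_M` are O(1) lattice sums.  All of it is row RHOA-6e's ledger.
Provenance: D1 formalisation swarm, unit `b2b-balaban-beta-d1-formalise-leaf-05` gen 13 (prover-b2b-balaban-beta-d1-formalise-leaf-05-g13-0), 2026-08-21,
first-refusal holder of (GH-a) COUNTING by R-FP-28 (d); «not in print; our bookkeeping»; no existing file touched.
-/

noncomputable section

namespace Summit.QuantumFields.BalabanUV.Beta.FP.GhostLoopCountingGramWords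


open Finset Real
open scoped BigOperators
open Literature.MathematicalPhysics.QuantumFieldTheory.Balaban1983to89.Beta.DyadicShell (Pt supNorm)
open Literature.MathematicalPhysics.QuantumFieldTheory.Balaban1983to89.Beta.GradedBubbles (supNorm_neg)
open Literature.MathematicalPhysics.QuantumFieldTheory.Balaban1983to89.Beta.BlockLegs (supNorm_add_le_real)
open Summit.QuantumFields.BalabanUV.Beta.FP.MixLoopPowerCounting (sum_exp_le sum_sq_mul_exp_le supNorm_cast_nonneg)
open Summit.QuantumFields.BalabanUV.Beta.FP.MixLoopPowerCountingMass (supNorm_zsmul_natCast_real)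
open Summit.QuantumFields.BalabanUV.Beta.FP.GhostLoopCountingFar (sum_exp_recentre_le)

/-! ## §1 An ALL-MASSIVE piece in (Mκ) currency -/

/-- [folklore] **THE `(1 + (‖z‖∕n)²)`-WEIGHTED MASS OF A SCALE-`n` EXPONENTIAL, RECENTRED**: for every finite `T ⊂ ℤ⁴`, centre `p`, rate `a > 0`, `n ≥ 1`, `C ≥ 0`,
`Σ_{z∈T} (1 + (‖z−p‖∞∕n)²)·(C·e^{−(a∕n)‖z−p‖∞}) ≤ C·((1 + 480·e^{a∕2}·(2∕a)⁴) + (1 + 9600·e^{a∕2}·(2∕a)⁶))·n⁴` (`sum_exp_le`: `n⁴`; `sum_sq_mul_exp_le`: `n⁶∕n²`). -/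
theorem sum_massive_sqWeight_le {C a : ℝ} (hC : 0 ≤ C) (ha : 0 < a) {n : ℕ} (hn : 1 ≤ n) (T : Finset Pt) (p : Pt) :
    ∑ z ∈ T, (1 + ((supNorm (z - p) : ℝ) / n) ^ 2) * (C * Real.exp (-(a / n) * (supNorm (z - p) : ℝ)))
      ≤ C * ((1 + 480 * Real.exp (a / 2) * (2 / a) ^ 4) + (1 + 9600 * Real.exp (a / 2) * (2 / a) ^ 6)) * (n : ℝ) ^ 4 := by
  have hn' : (0 : ℝ) < n := by exact_mod_cast hn
  -- recentre
  have hre : ∑ z ∈ T, (1 + ((supNorm (z - p) : ℝ) / n) ^ 2) * (C * Real.exp (-(a / n) * (supNorm (z - p) : ℝ)))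
      = ∑ w ∈ T.image (fun z => z - p), (1 + ((supNorm w : ℝ) / n) ^ 2) * (C * Real.exp (-(a / n) * (supNorm w : ℝ))) := by
    rw [Finset.sum_image fun x _ y _ hxy => sub_left_injective hxy]
  rw [hre]
  set T' := T.image (fun z => z - p)
  have h1 := sum_exp_le ha hn T'
  have h2 := sum_sq_mul_exp_le ha hn T'
  have hsplit : ∑ w ∈ T', (1 + ((supNorm w : ℝ) / n) ^ 2) * (C * Real.exp (-(a / n) * (supNorm w : ℝ)))
      = C * (∑ w ∈ T', Real.exp (-(a / n) * (supNorm w : ℝ)))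
        + C / (n : ℝ) ^ 2 * (∑ w ∈ T', (supNorm w : ℝ) ^ 2 * Real.exp (-(a / n) * (supNorm w : ℝ))) := by
    rw [Finset.mul_sum, Finset.mul_sum, ← Finset.sum_add_distrib]
    refine Finset.sum_congr rfl fun w _ => ?_
    have e : ((supNorm w : ℝ) / n) ^ 2 = (supNorm w : ℝ) ^ 2 / (n : ℝ) ^ 2 := by rw [div_pow]
    rw [e]
    ring
  rw [hsplit]
  have hn2 : (n : ℝ) ^ 6 / (n : ℝ) ^ 2 = (n : ℝ) ^ 4 := by
    rw [div_eq_iff (by positivity)]; ring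
  calc C * (∑ w ∈ T', Real.exp (-(a / n) * (supNorm w : ℝ)))
        + C / (n : ℝ) ^ 2 * (∑ w ∈ T', (supNorm w : ℝ) ^ 2 * Real.exp (-(a / n) * (supNorm w : ℝ)))
      ≤ C * ((1 + 480 * Real.exp (a / 2) * (2 / a) ^ 4) * (n : ℝ) ^ 4)
        + C / (n : ℝ) ^ 2 * ((1 + 9600 * Real.exp (a / 2) * (2 / a) ^ 6) * (n : ℝ) ^ 6) := by
        gcongr
    _ = C * ((1 + 480 * Real.exp (a / 2) * (2 / a) ^ 4) + (1 + 9600 * Real.exp (a / 2) * (2 / a) ^ 6)) * (n : ℝ) ^ 4 := by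
        have e : C / (n : ℝ) ^ 2 * ((1 + 9600 * Real.exp (a / 2) * (2 / a) ^ 6) * (n : ℝ) ^ 6)
            = C * (1 + 9600 * Real.exp (a / 2) * (2 / a) ^ 6) * ((n : ℝ) ^ 6 / (n : ℝ) ^ 2) := by ring
        rw [e, hn2]
        ring

/-- [folklore] **(Mκ) FOR AN ALL-MASSIVE PIECE.**  Letter: `|k b b′| ≤ C·e^{−(a∕n)‖b′−b‖∞}` for ALL `b, b′` (no window: both near and far).  Then for every finite
fine window `S` and coarse reference row `v₀`,
`Σ_{b∈S} Σ_{b′∈S} e^{−(δ∕(2n))‖b−n•v₀‖∞}·(1 + (‖b′−b‖∞∕n)²)·|k b b′| ≤ (1 + 480·e^{δ∕4}·(4∕δ)⁴)·n⁴·(C·((1 + 480e^{a∕2}(2∕a)⁴) + (1 + 9600e^{a∕2}(2∕a)⁶))·n⁴)`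
— the `hMκ` binder of `MixLoopPowerCountingMassQuartic.coarse_secondMoment_of_majorant` at `κ := |k|`; powers displayed `n⁴·n⁴`. -/
theorem majorantLetter_massive {k : Pt → Pt → ℝ} {C a δ : ℝ} {n : ℕ} (hδ : 0 < δ) (hC : 0 ≤ C) (ha : 0 < a) (hn : 1 ≤ n)
    (S : Finset Pt) (v₀ : Pt)
    (hk : ∀ b b', |k b b'| ≤ C * Real.exp (-(a / n) * (supNorm (b' - b) : ℝ))) :
    ∑ b ∈ S, ∑ b' ∈ S, Real.exp (-(δ / (2 * n)) * (supNorm (b - (n : ℤ) • v₀) : ℝ)) *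
        (1 + ((supNorm (b' - b) : ℝ) / n) ^ 2) * |k b b'|
      ≤ (1 + 480 * Real.exp (δ / 4) * (4 / δ) ^ 4) * (n : ℝ) ^ 4 *
          (C * ((1 + 480 * Real.exp (a / 2) * (2 / a) ^ 4) + (1 + 9600 * Real.exp (a / 2) * (2 / a) ^ 6)) * (n : ℝ) ^ 4) := by
  set B : ℝ := C * ((1 + 480 * Real.exp (a / 2) * (2 / a) ^ 4) + (1 + 9600 * Real.exp (a / 2) * (2 / a) ^ 6)) * (n : ℝ) ^ 4 with hB
  have hB0 : 0 ≤ B := by positivity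
  have hinner : ∀ b, ∑ b' ∈ S, (1 + ((supNorm (b' - b) : ℝ) / n) ^ 2) * |k b b'| ≤ B := by
    intro b
    calc ∑ b' ∈ S, (1 + ((supNorm (b' - b) : ℝ) / n) ^ 2) * |k b b'|
        ≤ ∑ b' ∈ S, (1 + ((supNorm (b' - b) : ℝ) / n) ^ 2) * (C * Real.exp (-(a / n) * (supNorm (b' - b) : ℝ))) :=
          Finset.sum_le_sum fun b' _ => mul_le_mul_of_nonneg_left (hk b b') (by positivity)
      _ ≤ B := sum_massive_sqWeight_le hC ha hn S b
  calc ∑ b ∈ S, ∑ b' ∈ S, Real.exp (-(δ / (2 * n)) * (supNorm (b - (n : ℤ) • v₀) : ℝ)) *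
          (1 + ((supNorm (b' - b) : ℝ) / n) ^ 2) * |k b b'|
      = ∑ b ∈ S, Real.exp (-(δ / (2 * n)) * (supNorm (b - (n : ℤ) • v₀) : ℝ)) *
          ∑ b' ∈ S, (1 + ((supNorm (b' - b) : ℝ) / n) ^ 2) * |k b b'| := by
        refine Finset.sum_congr rfl fun b _ => ?_
        rw [Finset.mul_sum]
        exact Finset.sum_congr rfl fun b' _ => by ring
    _ ≤ ∑ b ∈ S, Real.exp (-(δ / (2 * n)) * (supNorm (b - (n : ℤ) • v₀) : ℝ)) * B :=
        Finset.sum_le_sum fun b _ => mul_le_mul_of_nonneg_left (hinner b) (Real.exp_pos _).le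
    _ = (∑ b ∈ S, Real.exp (-(δ / (2 * n)) * (supNorm (b - (n : ℤ) • v₀) : ℝ))) * B := by rw [Finset.sum_mul]
    _ ≤ ((1 + 480 * Real.exp (δ / 4) * (4 / δ) ^ 4) * (n : ℝ) ^ 4) * B :=
        mul_le_mul_of_nonneg_right (sum_exp_recentre_le hδ hn S _) hB0
    _ = _ := by simp only [hB]

/-! ## §2 The two coarse trace words of the Gram loop: pointwise all-massive shapes -/

section Words

variable {V : Finset Pt} {Minv : Pt → Pt → ℝ} {D : Pt → Pt → Pt → ℝ} {D₂ : Pt → Pt → Pt → Pt → ℝ}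
  {C_M C_D C_D₂ K_V K_M δ δ_M : ℝ} {n : ℕ}

/-- [folklore] `e^{−r·x} ≤ e^{−(r∕2)·x}` for `r, x ≥ 0`. -/
theorem exp_full_le_half {r x : ℝ} (hr : 0 ≤ r) (hx : 0 ≤ x) : Real.exp (-r * x) ≤ Real.exp (-(r / 2) * x) :=
  Real.exp_le_exp.mpr (by nlinarith)

/-- [folklore] A decaying exponential is at most one: `e^{−r·x} ≤ 1` for `r, x ≥ 0`. -/
theorem exp_neg_le_one {r x : ℝ} (hr : 0 ≤ r) (hx : 0 ≤ x) : Real.exp (-r * x) ≤ 1 :=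
  Real.exp_le_one_iff.mpr (by nlinarith)

/-- [folklore] **THE CHAIN `b → n•v₂ → n•v₁ → b′`**: with `a = min δ δ_M` (`δ, δ_M > 0`, `n ≥ 1`),
`e^{−(δ_M∕2)‖v₁−v₂‖∞}·e^{−(δ∕(2n))‖b−n•v₂‖∞}·e^{−(δ∕(2n))‖b′−n•v₁‖∞} ≤ e^{−(a∕(2n))‖b′−b‖∞}`
(`‖b′−b‖∞ ≤ ‖b′−n•v₁‖∞ + n‖v₁−v₂‖∞ + ‖b−n•v₂‖∞`). -/
theorem exp_chain_le (hδ : 0 < δ) (hδM : 0 < δ_M) (hn : 1 ≤ n) (b b' v₁ v₂ : Pt) :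
    Real.exp (-(δ_M / 2) * (supNorm (v₁ - v₂) : ℝ)) * Real.exp (-(δ / (2 * n)) * (supNorm (b - (n : ℤ) • v₂) : ℝ))
        * Real.exp (-(δ / (2 * n)) * (supNorm (b' - (n : ℤ) • v₁) : ℝ))
      ≤ Real.exp (-(min δ δ_M / (2 * n)) * (supNorm (b' - b) : ℝ)) := by
  have hn' : (0 : ℝ) < n := by exact_mod_cast hn
  have hn1 : (1 : ℝ) ≤ n := by exact_mod_cast hn
  set a : ℝ := min δ δ_M with ha
  have ha0 : 0 < a := lt_min hδ hδM
  have haδ : a ≤ δ := min_le_left _ _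
  have haM : a ≤ δ_M := min_le_right _ _
  set x : ℝ := (supNorm (v₁ - v₂) : ℝ) with hx
  set y : ℝ := (supNorm (b - (n : ℤ) • v₂) : ℝ) with hy
  set z : ℝ := (supNorm (b' - (n : ℤ) • v₁) : ℝ) with hz
  have hx0 : 0 ≤ x := supNorm_cast_nonneg _
  have hy0 : 0 ≤ y := supNorm_cast_nonneg _
  have hz0 : 0 ≤ z := supNorm_cast_nonneg _
  -- the triangle inequality along the chain
  have htri : (supNorm (b' - b) : ℝ) ≤ z + n * x + y := by
    have e : b' - b = (b' - (n : ℤ) • v₁) + ((n : ℤ) • (v₁ - v₂)) + (-(b - (n : ℤ) • v₂)) := by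
      rw [smul_sub]; abel
    have h1 := supNorm_add_le_real ((b' - (n : ℤ) • v₁) + (n : ℤ) • (v₁ - v₂)) (-(b - (n : ℤ) • v₂))
    have h2 := supNorm_add_le_real (b' - (n : ℤ) • v₁) ((n : ℤ) • (v₁ - v₂))
    have h3 : (supNorm ((n : ℤ) • (v₁ - v₂)) : ℝ) = n * x := by rw [hx, supNorm_zsmul_natCast_real]
    have h4 : (supNorm (-(b - (n : ℤ) • v₂)) : ℝ) = y := by rw [hy, supNorm_neg]
    rw [e]
    linarith
  rw [← Real.exp_add, ← Real.exp_add]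
  apply Real.exp_le_exp.mpr
  -- compare exponents: each of the three halves is at rate ≥ a
  have e1 : -(δ_M / 2) * x ≤ -(a / (2 * n)) * (n * x) := by
    have : a / (2 * n) * (n * x) = (a / 2) * x := by field_simp
    rw [neg_mul, neg_mul, this]
    nlinarith
  have e2 : -(δ / (2 * n)) * y ≤ -(a / (2 * n)) * y := by
    have h : a / (2 * n) ≤ δ / (2 * n) := by gcongr
    nlinarith
  have e3 : -(δ / (2 * n)) * z ≤ -(a / (2 * n)) * z := by
    have h : a / (2 * n) ≤ δ / (2 * n) := by gcongr
    nlinarith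
  have hrate : 0 ≤ a / (2 * n) := by positivity
  calc -(δ_M / 2) * x + -(δ / (2 * n)) * y + -(δ / (2 * n)) * z
      ≤ -(a / (2 * n)) * (n * x) + -(a / (2 * n)) * y + -(a / (2 * n)) * z := by linarith
    _ = -(a / (2 * n)) * (z + n * x + y) := by ring
    _ ≤ -(a / (2 * n)) * (supNorm (b' - b) : ℝ) := by nlinarith

/-- [folklore] **THE WORD `tr(M⁻¹·M̈_{bb′})`**: under (Minv) (only its size `C_M` is used), (D₂) and (KV),
`|Σ_{v∈V} Σ_{v′∈V} Minv v′ v·D₂ b b′ v v′| ≤ C_M·C_D₂·K_V²·e^{−(δ∕n)‖b′−b‖∞}`. -/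
theorem abs_trace₂_le (hδ : 0 < δ) (hδM : 0 < δ_M) (hn : 1 ≤ n)
    (hM : ∀ v v', |Minv v v'| ≤ C_M * Real.exp (-δ_M * (supNorm (v - v') : ℝ)))
    (hD₂ : ∀ b b' v v', |D₂ b b' v v'| ≤ C_D₂ * Real.exp (-(δ / n) * (supNorm (b' - b) : ℝ)) *
        Real.exp (-(δ / n) * (supNorm (b - (n : ℤ) • v) : ℝ)) * Real.exp (-(δ / n) * (supNorm (b' - (n : ℤ) • v') : ℝ)))
    (hKV : ∀ b, ∑ v ∈ V, Real.exp (-(δ / (2 * n)) * (supNorm (b - (n : ℤ) • v) : ℝ)) ≤ K_V) (b b' : Pt) :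
    |∑ v ∈ V, ∑ v' ∈ V, Minv v' v * D₂ b b' v v'|
      ≤ C_M * C_D₂ * K_V ^ 2 * Real.exp (-(δ / n) * (supNorm (b' - b) : ℝ)) := by
  have hn' : (0 : ℝ) < n := by exact_mod_cast hn
  have hCM : 0 ≤ C_M := by
    have h := hM b b
    have : 0 < Real.exp (-δ_M * (supNorm (b - b) : ℝ)) := Real.exp_pos _
    nlinarith [abs_nonneg (Minv b b)]
  have hCD₂ : 0 ≤ C_D₂ := by
    have h := hD₂ b b b b
    have h1 : 0 < Real.exp (-(δ / n) * (supNorm (b - b) : ℝ)) := Real.exp_pos _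
    have h2 : 0 < Real.exp (-(δ / n) * (supNorm (b - (n : ℤ) • b) : ℝ)) := Real.exp_pos _
    have := abs_nonneg (D₂ b b b b)
    have h3 : 0 ≤ C_D₂ * (Real.exp (-(δ / n) * (supNorm (b - b) : ℝ)) * Real.exp (-(δ / n) * (supNorm (b - (n : ℤ) • b) : ℝ))
        * Real.exp (-(δ / n) * (supNorm (b - (n : ℤ) • b) : ℝ))) := by nlinarith
    exact nonneg_of_mul_nonneg_left h3 (by positivity)
  have hKV0 : 0 ≤ K_V := le_trans (Finset.sum_nonneg fun v _ => (Real.exp_pos _).le) (hKV b)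
  set E : ℝ := Real.exp (-(δ / n) * (supNorm (b' - b) : ℝ)) with hE
  set f : Pt → ℝ := fun v => Real.exp (-(δ / (2 * n)) * (supNorm (b - (n : ℤ) • v) : ℝ)) with hf
  set g : Pt → ℝ := fun v' => Real.exp (-(δ / (2 * n)) * (supNorm (b' - (n : ℤ) • v') : ℝ)) with hg
  -- pointwise
  have hpt : ∀ v v', |Minv v' v * D₂ b b' v v'| ≤ (C_M * C_D₂ * E) * (f v * g v') := by
    intro v v'
    rw [abs_mul]
    have h1 : |Minv v' v| ≤ C_M := (hM v' v).trans (by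
      have := exp_neg_le_one hδM.le (supNorm_cast_nonneg (v' - v))
      nlinarith)
    have hfv : Real.exp (-(δ / n) * (supNorm (b - (n : ℤ) • v) : ℝ)) ≤ f v := by
      have h := exp_full_le_half (r := δ / n) (by positivity) (supNorm_cast_nonneg (b - (n : ℤ) • v))
      have e : δ / n / 2 = δ / (2 * n) := by field_simp
      rw [e] at h; exact h
    have hgv : Real.exp (-(δ / n) * (supNorm (b' - (n : ℤ) • v') : ℝ)) ≤ g v' := by
      have h := exp_full_le_half (r := δ / n) (by positivity) (supNorm_cast_nonneg (b' - (n : ℤ) • v'))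
      have e : δ / n / 2 = δ / (2 * n) := by field_simp
      rw [e] at h; exact h
    have h2 : |D₂ b b' v v'| ≤ C_D₂ * E * (f v * g v') := by
      refine (hD₂ b b' v v').trans ?_
      rw [mul_assoc (C_D₂ * E)]
      exact mul_le_mul_of_nonneg_left (mul_le_mul hfv hgv (Real.exp_pos _).le (Real.exp_pos _).le) (by positivity)
    calc |Minv v' v| * |D₂ b b' v v'| ≤ C_M * (C_D₂ * E * (f v * g v')) := mul_le_mul h1 h2 (abs_nonneg _) hCM
      _ = (C_M * C_D₂ * E) * (f v * g v') := by ring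
  calc |∑ v ∈ V, ∑ v' ∈ V, Minv v' v * D₂ b b' v v'|
      ≤ ∑ v ∈ V, ∑ v' ∈ V, (C_M * C_D₂ * E) * (f v * g v') := by
        refine (Finset.abs_sum_le_sum_abs _ _).trans (Finset.sum_le_sum fun v _ =>
          (Finset.abs_sum_le_sum_abs _ _).trans (Finset.sum_le_sum fun v' _ => hpt v v'))
    _ = (C_M * C_D₂ * E) * ((∑ v ∈ V, f v) * (∑ v' ∈ V, g v')) := by
        rw [Finset.sum_mul_sum, Finset.mul_sum]
        refine Finset.sum_congr rfl fun v _ => ?_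
        rw [Finset.mul_sum]
    _ ≤ (C_M * C_D₂ * E) * (K_V * K_V) := by
        refine mul_le_mul_of_nonneg_left ?_ (by positivity)
        exact mul_le_mul (hKV b) (hKV b') (Finset.sum_nonneg fun v _ => (Real.exp_pos _).le) hKV0
    _ = C_M * C_D₂ * K_V ^ 2 * E := by ring

/-- [folklore] **THE WORD `tr(M⁻¹·Ṁ_b·M⁻¹·Ṁ_{b′})`**: under (Minv), (KM), (D), (KV),
`|Σ_{v₁,v₂,v₃,v₄∈V} Minv v₁ v₂·D b v₂ v₃·Minv v₃ v₄·D b′ v₄ v₁| ≤ C_M²·C_D²·K_M²·K_V²·e^{−(min(δ,δ_M)∕(2n))‖b′−b‖∞}` — half of each of the three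
exponentials along the chain `b → n•v₂ → n•v₁ → b′` pays the separation (`exp_chain_le`), the other halves and the remaining factors pay the four coarse sums. -/
theorem abs_trace₄_le (hδ : 0 < δ) (hδM : 0 < δ_M) (hn : 1 ≤ n)
    (hM : ∀ v v', |Minv v v'| ≤ C_M * Real.exp (-δ_M * (supNorm (v - v') : ℝ)))
    (hKM : ∀ v, ∑ v' ∈ V, Real.exp (-(δ_M / 2) * (supNorm (v - v') : ℝ)) ≤ K_M)
    (hD : ∀ b v v', |D b v v'| ≤ C_D * Real.exp (-(δ / n) * (supNorm (b - (n : ℤ) • v) : ℝ)) *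
        Real.exp (-(δ / n) * (supNorm (b - (n : ℤ) • v') : ℝ)))
    (hKV : ∀ b, ∑ v ∈ V, Real.exp (-(δ / (2 * n)) * (supNorm (b - (n : ℤ) • v) : ℝ)) ≤ K_V) (b b' : Pt) :
    |∑ v₁ ∈ V, ∑ v₂ ∈ V, ∑ v₃ ∈ V, ∑ v₄ ∈ V, Minv v₁ v₂ * D b v₂ v₃ * Minv v₃ v₄ * D b' v₄ v₁|
      ≤ C_M ^ 2 * C_D ^ 2 * K_M ^ 2 * K_V ^ 2 * Real.exp (-(min δ δ_M / (2 * n)) * (supNorm (b' - b) : ℝ)) := by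
  have hn' : (0 : ℝ) < n := by exact_mod_cast hn
  have hCM : 0 ≤ C_M := by
    have h := hM b b
    have : 0 < Real.exp (-δ_M * (supNorm (b - b) : ℝ)) := Real.exp_pos _
    nlinarith [abs_nonneg (Minv b b)]
  have hCD : 0 ≤ C_D := by
    have h := hD b b b
    have h1 : 0 < Real.exp (-(δ / n) * (supNorm (b - (n : ℤ) • b) : ℝ)) := Real.exp_pos _
    have := abs_nonneg (D b b b)
    have h3 : 0 ≤ C_D * (Real.exp (-(δ / n) * (supNorm (b - (n : ℤ) • b) : ℝ)) * Real.exp (-(δ / n) * (supNorm (b - (n : ℤ) • b) : ℝ))) := by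
      nlinarith
    exact nonneg_of_mul_nonneg_left h3 (by positivity)
  have hKV0 : 0 ≤ K_V := le_trans (Finset.sum_nonneg fun v _ => (Real.exp_pos _).le) (hKV b)
  have hKM0 : 0 ≤ K_M := le_trans (Finset.sum_nonneg fun v _ => (Real.exp_pos _).le) (hKM b)
  -- the half-exponentials
  set E : ℝ := Real.exp (-(min δ δ_M / (2 * n)) * (supNorm (b' - b) : ℝ)) with hE
  set A : Pt → Pt → ℝ := fun v₁ v₂ => Real.exp (-(δ_M / 2) * (supNorm (v₁ - v₂) : ℝ)) with hA
  set F : Pt → ℝ := fun v => Real.exp (-(δ / (2 * n)) * (supNorm (b - (n : ℤ) • v) : ℝ)) with hF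
  set G : Pt → ℝ := fun v => Real.exp (-(δ / (2 * n)) * (supNorm (b' - (n : ℤ) • v) : ℝ)) with hG
  have hA0 : ∀ v₁ v₂, 0 ≤ A v₁ v₂ := fun _ _ => (Real.exp_pos _).le
  have hF0 : ∀ v, 0 ≤ F v := fun _ => (Real.exp_pos _).le
  have hG0 : ∀ v, 0 ≤ G v := fun _ => (Real.exp_pos _).le
  have hA1 : ∀ v₁ v₂, A v₁ v₂ ≤ 1 := fun v₁ v₂ => exp_neg_le_one (by positivity) (supNorm_cast_nonneg _)
  have hG1 : ∀ v, G v ≤ 1 := fun v => exp_neg_le_one (by positivity) (supNorm_cast_nonneg _)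
  have hrate : δ / n / 2 = δ / (2 * n) := by field_simp
  -- leg letters in half-exponential form
  have hMh : ∀ v₁ v₂, |Minv v₁ v₂| ≤ C_M * (A v₁ v₂ * A v₁ v₂) := by
    intro v₁ v₂
    refine (hM v₁ v₂).trans (le_of_eq ?_)
    rw [hA, ← Real.exp_add]; congr 1; ring
  have hDh : ∀ c v v', |D c v v'| ≤ C_D * (Real.exp (-(δ / (2 * n)) * (supNorm (c - (n : ℤ) • v) : ℝ)) ^ 2
      * Real.exp (-(δ / (2 * n)) * (supNorm (c - (n : ℤ) • v') : ℝ)) ^ 2) := by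
    intro c v v'
    refine (hD c v v').trans (le_of_eq ?_)
    rw [sq, sq, ← Real.exp_add, ← Real.exp_add, mul_assoc]; congr 2 <;> (congr 1; field_simp; ring)
  -- pointwise bound of one summand: chain × summable part
  have hpt : ∀ v₁ v₂ v₃ v₄, |Minv v₁ v₂ * D b v₂ v₃ * Minv v₃ v₄ * D b' v₄ v₁|
      ≤ (C_M ^ 2 * C_D ^ 2 * E) * (A v₁ v₂ * F v₂ * F v₃ * A v₃ v₄) := by
    intro v₁ v₂ v₃ v₄
    have hchain : A v₁ v₂ * F v₂ * G v₁ ≤ E := exp_chain_le hδ hδM hn b b' v₁ v₂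
    have h1 := hMh v₁ v₂
    have h2 := hDh b v₂ v₃
    have h3 := hMh v₃ v₄
    have h4 := hDh b' v₄ v₁
    rw [abs_mul, abs_mul, abs_mul]
    -- |D b v₂ v₃| ≤ C_D * F v₂² * F v₃² ≤ C_D * F v₂² * F v₃ ; |D b' v₄ v₁| ≤ C_D * G v₄² * G v₁² ≤ C_D * G v₁
    have h2' : |D b v₂ v₃| ≤ C_D * (F v₂ * F v₂ * F v₃) := by
      refine h2.trans ?_
      have hF1 : F v₃ ≤ 1 := exp_neg_le_one (by positivity) (supNorm_cast_nonneg _)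
      have : F v₂ ^ 2 * F v₃ ^ 2 ≤ F v₂ * F v₂ * F v₃ := by
        rw [sq, sq]; exact mul_le_mul_of_nonneg_left (mul_le_of_le_one_right (hF0 v₃) hF1) (mul_nonneg (hF0 v₂) (hF0 v₂))
      simpa [hF] using mul_le_mul_of_nonneg_left this hCD
    have h4' : |D b' v₄ v₁| ≤ C_D * G v₁ := by
      refine h4.trans ?_
      have : G v₄ ^ 2 * G v₁ ^ 2 ≤ G v₁ := by
        have hG41 : G v₄ ^ 2 ≤ 1 := pow_le_one₀ (hG0 v₄) (hG1 v₄)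
        have hG11 : G v₁ ^ 2 ≤ G v₁ := by rw [sq]; exact mul_le_of_le_one_left (hG0 v₁) (hG1 v₁)
        calc G v₄ ^ 2 * G v₁ ^ 2 ≤ 1 * G v₁ ^ 2 := mul_le_mul_of_nonneg_right hG41 (sq_nonneg _)
          _ ≤ G v₁ := by rw [one_mul]; exact hG11
      simpa [hG] using mul_le_mul_of_nonneg_left this hCD
    have h3' : |Minv v₃ v₄| ≤ C_M * A v₃ v₄ := by
      refine h3.trans ?_
      exact mul_le_mul_of_nonneg_left (mul_le_of_le_one_right (hA0 v₃ v₄) (hA1 v₃ v₄)) hCM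
    calc |Minv v₁ v₂| * |D b v₂ v₃| * |Minv v₃ v₄| * |D b' v₄ v₁|
        ≤ (C_M * (A v₁ v₂ * A v₁ v₂)) * (C_D * (F v₂ * F v₂ * F v₃)) * (C_M * A v₃ v₄) * (C_D * G v₁) := by
          have a0 : 0 ≤ C_M * (A v₁ v₂ * A v₁ v₂) := by positivity
          have b0 : 0 ≤ C_D * (F v₂ * F v₂ * F v₃) := by positivity
          have c0 : 0 ≤ C_M * A v₃ v₄ := by positivity
          exact mul_le_mul (mul_le_mul (mul_le_mul h1 h2' (abs_nonneg _) a0) h3' (abs_nonneg _) (mul_nonneg a0 b0))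
            h4' (abs_nonneg _) (mul_nonneg (mul_nonneg a0 b0) c0)
      _ = (C_M ^ 2 * C_D ^ 2) * (A v₁ v₂ * F v₂ * G v₁) * (A v₁ v₂ * F v₂ * F v₃ * A v₃ v₄) := by ring
      _ ≤ (C_M ^ 2 * C_D ^ 2) * E * (A v₁ v₂ * F v₂ * F v₃ * A v₃ v₄) := by
          have : 0 ≤ A v₁ v₂ * F v₂ * F v₃ * A v₃ v₄ := by positivity
          exact mul_le_mul_of_nonneg_right (mul_le_mul_of_nonneg_left hchain (by positivity)) this
      _ = _ := by ring
  -- the four coarse sums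
  have hsum4 : ∀ v₃, ∑ v₄ ∈ V, A v₃ v₄ ≤ K_M := fun v₃ => hKM v₃
  have hsum3 : ∑ v₃ ∈ V, F v₃ ≤ K_V := hKV b
  have hsum1 : ∀ v₂, ∑ v₁ ∈ V, A v₁ v₂ ≤ K_M := by
    intro v₂
    have e : ∀ v₁, A v₁ v₂ = Real.exp (-(δ_M / 2) * (supNorm (v₂ - v₁) : ℝ)) := by
      intro v₁; simp only [hA]; rw [← supNorm_neg, neg_sub]
    rw [Finset.sum_congr rfl fun v₁ _ => e v₁]
    exact hKM v₂
  have hsum2 : ∑ v₂ ∈ V, F v₂ ≤ K_V := hKV b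
  calc |∑ v₁ ∈ V, ∑ v₂ ∈ V, ∑ v₃ ∈ V, ∑ v₄ ∈ V, Minv v₁ v₂ * D b v₂ v₃ * Minv v₃ v₄ * D b' v₄ v₁|
      ≤ ∑ v₁ ∈ V, ∑ v₂ ∈ V, ∑ v₃ ∈ V, ∑ v₄ ∈ V, (C_M ^ 2 * C_D ^ 2 * E) * (A v₁ v₂ * F v₂ * F v₃ * A v₃ v₄) := by
        refine (Finset.abs_sum_le_sum_abs _ _).trans (Finset.sum_le_sum fun v₁ _ =>
          (Finset.abs_sum_le_sum_abs _ _).trans (Finset.sum_le_sum fun v₂ _ =>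
            (Finset.abs_sum_le_sum_abs _ _).trans (Finset.sum_le_sum fun v₃ _ =>
              (Finset.abs_sum_le_sum_abs _ _).trans (Finset.sum_le_sum fun v₄ _ => hpt v₁ v₂ v₃ v₄))))
    _ = (C_M ^ 2 * C_D ^ 2 * E) * ∑ v₁ ∈ V, ∑ v₂ ∈ V, (A v₁ v₂ * F v₂) * ∑ v₃ ∈ V, F v₃ * ∑ v₄ ∈ V, A v₃ v₄ := by
        rw [Finset.mul_sum]
        refine Finset.sum_congr rfl fun v₁ _ => ?_
        rw [Finset.mul_sum]
        refine Finset.sum_congr rfl fun v₂ _ => ?_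
        rw [Finset.mul_sum, Finset.mul_sum]
        refine Finset.sum_congr rfl fun v₃ _ => ?_
        rw [Finset.mul_sum, Finset.mul_sum, Finset.mul_sum]
        refine Finset.sum_congr rfl fun v₄ _ => ?_
        ring
    _ ≤ (C_M ^ 2 * C_D ^ 2 * E) * ∑ v₁ ∈ V, ∑ v₂ ∈ V, (A v₁ v₂ * F v₂) * (K_V * K_M) := by
        refine mul_le_mul_of_nonneg_left (Finset.sum_le_sum fun v₁ _ => Finset.sum_le_sum fun v₂ _ => ?_) (by positivity)
        refine mul_le_mul_of_nonneg_left ?_ (by positivity)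
        calc ∑ v₃ ∈ V, F v₃ * ∑ v₄ ∈ V, A v₃ v₄ ≤ ∑ v₃ ∈ V, F v₃ * K_M :=
              Finset.sum_le_sum fun v₃ _ => mul_le_mul_of_nonneg_left (hsum4 v₃) (hF0 v₃)
          _ = (∑ v₃ ∈ V, F v₃) * K_M := by rw [Finset.sum_mul]
          _ ≤ K_V * K_M := mul_le_mul_of_nonneg_right hsum3 hKM0
    _ = (C_M ^ 2 * C_D ^ 2 * E) * (K_V * K_M) * ∑ v₂ ∈ V, F v₂ * ∑ v₁ ∈ V, A v₁ v₂ := by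
        have hcomm : ∑ v₁ ∈ V, ∑ v₂ ∈ V, (A v₁ v₂ * F v₂) * (K_V * K_M)
            = (K_V * K_M) * ∑ v₂ ∈ V, F v₂ * ∑ v₁ ∈ V, A v₁ v₂ := by
          rw [Finset.sum_comm (s := V) (t := V) (f := fun v₁ v₂ => (A v₁ v₂ * F v₂) * (K_V * K_M)), Finset.mul_sum]
          refine Finset.sum_congr rfl fun v₂ _ => ?_
          rw [Finset.mul_sum, Finset.mul_sum]
          refine Finset.sum_congr rfl fun v₁ _ => ?_
          ring
        rw [hcomm]
        ring
    _ ≤ (C_M ^ 2 * C_D ^ 2 * E) * (K_V * K_M) * (K_V * K_M) := by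
        refine mul_le_mul_of_nonneg_left ?_ (by positivity)
        calc ∑ v₂ ∈ V, F v₂ * ∑ v₁ ∈ V, A v₁ v₂ ≤ ∑ v₂ ∈ V, F v₂ * K_M :=
              Finset.sum_le_sum fun v₂ _ => mul_le_mul_of_nonneg_left (hsum1 v₂) (hF0 v₂)
          _ = (∑ v₂ ∈ V, F v₂) * K_M := by rw [Finset.sum_mul]
          _ ≤ K_V * K_M := mul_le_mul_of_nonneg_right hsum2 hKM0
    _ = C_M ^ 2 * C_D ^ 2 * K_M ^ 2 * K_V ^ 2 * E := by ring

end Words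

end Summit.QuantumFields.BalabanUV.Beta.FP.GhostLoopCountingGramWords

end
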